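/-
Helper lemmas for CombDescentStep (stmt-RiemannHypothesis-3184)
These are building blocks for the comb field estimate.
-/

import Mathlib
import HarnessLib

open Complex Real

noncomputable section

namespace Summit.RiemannHypothesis.RiemannHypothesis.Theorems.EarlyAppointmentsCombHelpers

set_option linter.dupNamespace false

/-! ### Basic complex arithmetic for comb sums -/

/-- For z₀ = x₀ + ih and real x, the imaginary part of 1/(z₀ - x) is -h/((x₀ - x)² + h²).
This is negative when h > 0 (pointing downward), which is the key sign for Rouché. -/
theorem im_inv_z₀_sub_real (x₀ h x : ℝ) (_hh : h ≠ 0) :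
    (((x₀ : ℂ) + h * Complex.I - (x : ℂ))⁻¹).im = -h / ((x₀ - x) ^ 2 + h ^ 2) := by
  have hz : (x₀ : ℂ) + h * Complex.I - (x : ℂ) = ((x₀ - x) : ℂ) + h * Complex.I := by ring
  rw [hz]
  -- Use Complex.inv_im: z⁻¹.im = -z.im / normSq z
  rw [Complex.inv_im]
  simp only [Complex.add_im, Complex.ofReal_im, Complex.sub_im, Complex.mul_im, Complex.ofReal_re,
             Complex.I_re, Complex.I_im, mul_zero, mul_one, zero_add, add_zero, sub_zero]
  -- Now goal is -h / normSq(...) = -h / ((x₀ - x)² + h²)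
  congr 1
  have hsub : (↑x₀ - ↑x : ℂ) = ((x₀ - x : ℝ) : ℂ) := by push_cast; rfl
  rw [hsub, Complex.normSq_add_mul_I]

/-- For h > 0, the imaginary part of 1/(z₀ - x) is negative (pointing downward). -/
theorem im_inv_z₀_sub_real_neg (x₀ h x : ℝ) (hh : 0 < h) :
    (((x₀ : ℂ) + h * Complex.I - (x : ℂ))⁻¹).im < 0 := by
  rw [im_inv_z₀_sub_real x₀ h x hh.ne']
  have hdenom : 0 < (x₀ - x) ^ 2 + h ^ 2 := by nlinarith [sq_nonneg (x₀ - x), sq_nonneg h]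
  have hnum : -h < 0 := neg_neg_of_pos hh
  exact div_neg_of_neg_of_pos hnum hdenom

/-- Bound on the imaginary part magnitude: |Im(1/(z₀ - x))| ≤ 1/h for |x - x₀| ≤ R. -/
theorem abs_im_inv_z₀_sub_real_le (x₀ h x : ℝ) (hh : 0 < h) :
    |((( x₀ : ℂ) + h * Complex.I - (x : ℂ))⁻¹).im| ≤ 1 / h := by
  rw [im_inv_z₀_sub_real x₀ h x hh.ne']
  have hdenom : (x₀ - x) ^ 2 + h ^ 2 ≥ h ^ 2 := by nlinarith [sq_nonneg (x₀ - x)]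
  have hh2 : 0 < h ^ 2 := sq_pos_of_pos hh
  rw [abs_div, abs_neg, abs_of_pos hh, abs_of_pos (by nlinarith [sq_nonneg (x₀ - x)] : 0 < (x₀ - x) ^ 2 + h ^ 2)]
  calc h / ((x₀ - x) ^ 2 + h ^ 2)
      ≤ h / h ^ 2 := by
        apply div_le_div_of_nonneg_left hh.le
        · nlinarith [sq_nonneg (x₀ - x)]
        · exact hdenom
    _ = 1 / h := by field_simp

end Summit.RiemannHypothesis.RiemannHypothesis.Theorems.EarlyAppointmentsCombHelpers

end
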